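import Mathlib
import Literature.Analysis.Convexity.AnisotropicPerimeterPolytopePrism
import HarnessLib

/-!
# Cavalieri's principle by parallel planes in `ℝ³`, in the chart language of the facet toolkit

Topic `Literature/Analysis/Convexity`; namespace `Literature.Analysis.Convexity`.  Companion of
`AnisotropicPerimeterPolytopePrism.lean` (facet areas as chart areas / prism volumes).

For an orthonormal frame `(U, V, a)` of `EuclideanSpace ℝ (Fin 3)` and a base point `p`, the map
`(s, y) ↦ p + s a + y₁ U + y₂ V` is a measure-preserving parametrisation of `ℝ³` by `ℝ × (ℝ × ℝ)`;
hence (Fubini–Tonelli) for every measurable `S`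

* `volume_eq_lintegral_volume_chartSlice` — **Cavalieri**:
  `|S| = ∫ |{y : ℝ × ℝ | p + s a + y₁U + y₂V ∈ S}| ds`, the integrand being the chart area of the
  slice `S ∩ {⟪a, ·⟫ = ⟪a, p⟫ + s}` (`measurable_volume_chartSlice`: it is a measurable function of `s`);
* `lintegral_volume_chartSlice_levelSet` — **the coarea formula for an affine function**: for
  `g ≠ 0` and `f = ⟪g, ·⟫ + c`, `∫ |chart area of S ∩ {f = t}| dt = ‖g‖ · |S|`, the slice at level `t`
  being read in the chart based at the point `((t − c)/‖g‖²) g` of the plane `{f = t}`;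
* `lintegral_volume_prism_levelSet` — the same with the slice area written chart-free as the volume
  of the unit prism over `S ∩ {f = t}` along `g/‖g‖` (`volume_prism_eq_volume_chartPreimage`).

These are the inputs for integrating facet sums of level sets `{f > t}` of piecewise-affine
functions over the level `t` (for an affine `f` on a cell `c`, `∫ area({f = t} ∩ c) dt = ‖∇f‖·|c|`).

[cite: EvansGariepy2015, §3.4 Thm 3.10 (coarea formula) with A ⊆ ℝ³, m = 1, and §3.4.4 Thm 3.13 (i)
(∫ |Df| dx = ∫ H^{n−1}({f = t}) dt); §1.4 Thm 1.22 (Fubini); §3.4.1 Lemma 3.5 (the linear case)] — here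
only the elementary affine case (for an affine map the coarea formula IS Fubini's theorem after a rotation).
-/

noncomputable section

open MeasureTheory Set
open scoped RealInnerProductSpace ENNReal

namespace Literature.Analysis.Convexity

/-- The affine chart `(s, y) ↦ p + s a + y₁ U + y₂ V` of `ℝ³` adapted to a frame. [folklore] -/
private theorem continuous_frameChart (a U V p : EuclideanSpace ℝ (Fin 3)) :
    Continuous fun q : ℝ × (ℝ × ℝ) => p + q.1 • a + q.2.1 • U + q.2.2 • V := by
  fun_prop

/-- The set of frame coordinates of a measurable set is measurable. [folklore] -/
private theorem measurableSet_frameCoords {S : Set (EuclideanSpace ℝ (Fin 3))} (hS : MeasurableSet S)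
    (a U V p : EuclideanSpace ℝ (Fin 3)) :
    MeasurableSet {q : ℝ × (ℝ × ℝ) | p + q.1 • a + q.2.1 • U + q.2.2 • V ∈ S} :=
  hS.preimage (continuous_frameChart a U V p).measurable

/-- **The slice-area function is measurable**: `s ↦ |{y : ℝ × ℝ | p + s a + y₁U + y₂V ∈ S}|` is a
measurable function of the height `s`, for every measurable `S` (Tonelli).
[cite: EvansGariepy2015, §3.4.1 Lemma 3.5 (ii) (measurability of the slice measure; here the affine case
of §1.4 Thm 1.22, Fubini)] -/
theorem measurable_volume_chartSlice {S : Set (EuclideanSpace ℝ (Fin 3))} (hS : MeasurableSet S)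
    (a U V p : EuclideanSpace ℝ (Fin 3)) :
    Measurable fun s : ℝ => volume {y : ℝ × ℝ | p + s • a + y.1 • U + y.2 • V ∈ S} := by
  have h := measurable_measure_prodMk_left (ν := (volume : Measure (ℝ × ℝ)))
    (measurableSet_frameCoords hS a U V p)
  have hfun : (fun s : ℝ => volume {y : ℝ × ℝ | p + s • a + y.1 • U + y.2 • V ∈ S}) =
      fun s : ℝ => (volume : Measure (ℝ × ℝ))
        (Prod.mk s ⁻¹' {q : ℝ × (ℝ × ℝ) | p + q.1 • a + q.2.1 • U + q.2.2 • V ∈ S}) := by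
    funext s; rfl
  rw [hfun]; exact h

/-- Dilation on the line for the lower integral: `∫ G(r⁻¹ t) dt = r ∫ G` (`r > 0`). [folklore] -/
private theorem lintegral_comp_inv_mul (G : ℝ → ℝ≥0∞) {r : ℝ} (hr : 0 < r) :
    ∫⁻ t, G (r⁻¹ * t) = ENNReal.ofReal r * ∫⁻ s, G s := by
  calc ∫⁻ t, G (r⁻¹ * t) = ∫⁻ s, G s ∂(Measure.map (r⁻¹ * ·) volume) :=
        (lintegral_map_equiv G (Homeomorph.mulLeft₀ r⁻¹ (inv_ne_zero hr.ne')).toMeasurableEquiv).symm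
    _ = ENNReal.ofReal r * ∫⁻ s, G s := by
        rw [Real.map_volume_mul_left (inv_ne_zero hr.ne'), lintegral_smul_measure, smul_eq_mul,
          inv_inv, abs_of_pos hr]

/-- **Cavalieri's principle by parallel planes.**  For an orthonormal frame `(U, V, a)` of `ℝ³`,
a base point `p` and a measurable set `S`:
`|S| = ∫⁻ s, |{y : ℝ × ℝ | p + s a + y₁ U + y₂ V ∈ S}|` — the volume is the integral over the
height `s` of the chart areas of the slices `S ∩ {⟪a, ·⟫ = ⟪a, p⟫ + s}`.
[cite: EvansGariepy2015, §1.4 Thm 1.22 (Fubini); the slicing form is the case m = 1 of §3.4 Thm 3.10 for the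
linear map x ↦ ⟪a, x⟫, §3.4.1 Lemma 3.5 (Cavalieri's principle)] -/
theorem volume_eq_lintegral_volume_chartSlice {a U V : EuclideanSpace ℝ (Fin 3)} (ha : ‖a‖ = 1)
    (hU : ‖U‖ = 1) (hV : ‖V‖ = 1) (hUV : ⟪U, V⟫ = 0) (haU : ⟪a, U⟫ = 0) (haV : ⟪a, V⟫ = 0)
    (p : EuclideanSpace ℝ (Fin 3)) {S : Set (EuclideanSpace ℝ (Fin 3))} (hS : MeasurableSet S) :
    volume S = ∫⁻ s : ℝ, volume {y : ℝ × ℝ | p + s • a + y.1 • U + y.2 • V ∈ S} := by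
  classical
  -- the orthonormal basis `b = (U, V, a)`
  have hon := orthonormal_vec_three ha hU hV hUV haU haV
  have hsp : ⊤ ≤ Submodule.span ℝ (Set.range ![U, V, a]) :=
    (hon.linearIndependent.span_eq_top_of_card_eq_finrank (by simp)).ge
  set b : OrthonormalBasis (Fin 3) ℝ (EuclideanSpace ℝ (Fin 3)) := OrthonormalBasis.mk hon hsp with hb
  have hb0 : b 0 = U := by simp [hb]
  have hb1 : b 1 = V := by simp [hb]
  have hb2 : b 2 = a := by simp [hb]
  have haa : ⟪a, a⟫ = 1 := by rw [real_inner_self_eq_norm_sq, ha, one_pow]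
  have hUU : ⟪U, U⟫ = 1 := by rw [real_inner_self_eq_norm_sq, hU, one_pow]
  have hVV : ⟪V, V⟫ = 1 := by rw [real_inner_self_eq_norm_sq, hV, one_pow]
  have hUa : ⟪U, a⟫ = 0 := by rw [real_inner_comm]; exact haU
  have hVa : ⟪V, a⟫ = 0 := by rw [real_inner_comm]; exact haV
  have hVU : ⟪V, U⟫ = 0 := by rw [real_inner_comm]; exact hUV
  -- the measure-preserving equivalences (as in `volume_prism_eq_volume_chartPreimage`)
  let e : EuclideanSpace ℝ (Fin 3) ≃ᵐ (Fin 3 → ℝ) :=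
    ((MeasurableEquiv.subRight p).trans b.repr.toHomeomorph.toMeasurableEquiv).trans
      (MeasurableEquiv.toLp 2 (Fin 3 → ℝ)).symm
  have he_apply : ∀ (x : EuclideanSpace ℝ (Fin 3)) (i : Fin 3), e x i = ⟪b i, x - p⟫ := by
    intro x i
    simp only [e, MeasurableEquiv.coe_trans, Function.comp_apply,
      Homeomorph.toMeasurableEquiv_coe, LinearIsometryEquiv.coe_toHomeomorph,
      MeasurableEquiv.toLp_symm_apply, OrthonormalBasis.repr_apply_apply]
    rfl
  have he : MeasurePreserving e volume volume := by
    have hfun : (⇑e : EuclideanSpace ℝ (Fin 3) → (Fin 3 → ℝ)) =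
        (WithLp.ofLp ∘ ⇑b.repr) ∘ fun x => x - p := by
      funext x; rfl
    rw [hfun]
    exact ((PiLp.volume_preserving_ofLp (Fin 3)).comp b.measurePreserving_repr).comp
      (measurePreserving_sub_right (volume : Measure (EuclideanSpace ℝ (Fin 3))) p)
  let e₂ : (Fin 3 → ℝ) ≃ᵐ ℝ × (Fin 2 → ℝ) := MeasurableEquiv.piFinSuccAbove (fun _ => ℝ) 2
  have he₂ : MeasurePreserving e₂ volume volume := volume_preserving_piFinSuccAbove (fun _ => ℝ) 2
  let e₃ : (Fin 2 → ℝ) ≃ᵐ ℝ × ℝ := MeasurableEquiv.finTwoArrow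
  have he₃ : MeasurePreserving e₃ volume volume := volume_preserving_finTwoArrow ℝ
  set T : Set (ℝ × (Fin 2 → ℝ)) :=
    {q : ℝ × (Fin 2 → ℝ) | p + q.1 • a + q.2 0 • U + q.2 1 • V ∈ S} with hT
  have hTm : MeasurableSet T := by
    have hc : Continuous fun q : ℝ × (Fin 2 → ℝ) => p + q.1 • a + q.2 0 • U + q.2 1 • V := by
      fun_prop
    exact hS.preimage hc.measurable
  have h20 : Fin.succAbove (2 : Fin 3) 0 = 0 := by decide
  have h21 : Fin.succAbove (2 : Fin 3) 1 = 1 := by decide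
  -- `S` in the frame coordinates is `T`
  have hset : S = e ⁻¹' (e₂ ⁻¹' T) := by
    ext x
    simp only [Set.mem_preimage, MeasurableEquiv.piFinSuccAbove_apply, Fin.insertNthEquiv_symm_apply,
      Fin.removeNth, h20, h21, he_apply, hb0, hb1, hb2, e₂, hT, Set.mem_setOf_eq]
    have h := frame_expansion_three ha hU hV hUV haU haV (x - p)
    have hx : p + ⟪a, x - p⟫ • a + ⟪U, x - p⟫ • U + ⟪V, x - p⟫ • V = x := by
      calc p + ⟪a, x - p⟫ • a + ⟪U, x - p⟫ • U + ⟪V, x - p⟫ • V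
          = p + (⟪U, x - p⟫ • U + ⟪V, x - p⟫ • V + ⟪a, x - p⟫ • a) := by abel
        _ = x := by rw [h]; abel
    rw [hx]
  have hvol : volume S = volume (e ⁻¹' (e₂ ⁻¹' T)) := congrArg volume hset
  rw [hvol, he.measure_preimage_equiv, he₂.measure_preimage_equiv, Measure.volume_eq_prod,
    Measure.prod_apply hTm]
  congr 1
  funext s
  have hsl : Prod.mk s ⁻¹' T = e₃ ⁻¹' {y : ℝ × ℝ | p + s • a + y.1 • U + y.2 • V ∈ S} := by
    ext w
    simp [hT, e₃, MeasurableEquiv.finTwoArrow_apply]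
  rw [hsl, he₃.measure_preimage_equiv]

/-- **Coarea formula for an affine function (chart form).**  Let `g ≠ 0`, `c ∈ ℝ`, `f = ⟪g, ·⟫ + c`,
and let `U, V` be an orthonormal pair orthogonal to `g`.  For every measurable `S ⊆ ℝ³`,
`∫⁻ t, |{y : ℝ × ℝ | ((t − c)/‖g‖²) g + y₁U + y₂V ∈ S}| = ‖g‖ · |S|`: the chart areas of the level
slices `S ∩ {f = t}` (each read in the isometric chart of the plane `{f = t}` based at
`((t − c)/‖g‖²) g`) integrate to `‖∇f‖ · |S|`.
[cite: EvansGariepy2015, §3.4 Thm 3.10 and §3.4.4 Thm 3.13 (i) (coarea, m = 1), affine case = §1.4 Thm 1.22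
(Fubini) after a rotation, cf. §3.4.1 Lemma 3.5] -/
theorem lintegral_volume_chartSlice_levelSet {g U V : EuclideanSpace ℝ (Fin 3)} (hg : g ≠ 0)
    (hU : ‖U‖ = 1) (hV : ‖V‖ = 1) (hUV : ⟪U, V⟫ = 0) (hgU : ⟪g, U⟫ = 0) (hgV : ⟪g, V⟫ = 0)
    (c : ℝ) {S : Set (EuclideanSpace ℝ (Fin 3))} (hS : MeasurableSet S) :
    ∫⁻ t : ℝ, volume {y : ℝ × ℝ | ((t - c) / ‖g‖ ^ 2) • g + y.1 • U + y.2 • V ∈ S} =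
      ENNReal.ofReal ‖g‖ * volume S := by
  have hgn : 0 < ‖g‖ := norm_pos_iff.mpr hg
  set a : EuclideanSpace ℝ (Fin 3) := ‖g‖⁻¹ • g with ha_def
  have ha : ‖a‖ = 1 := by
    rw [ha_def, norm_smul, norm_inv, norm_norm, inv_mul_cancel₀ hgn.ne']
  have haU : ⟪a, U⟫ = 0 := by rw [ha_def, inner_smul_left, hgU]; simp
  have haV : ⟪a, V⟫ = 0 := by rw [ha_def, inner_smul_left, hgV]; simp
  -- Cavalieri in direction `a` with base point `0`
  have hcav := volume_eq_lintegral_volume_chartSlice ha hU hV hUV haU haV 0 hS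
  -- the slice at level `t` is the slice at height `s = (t - c)/‖g‖`
  have hpt : ∀ t : ℝ, ((t - c) / ‖g‖ ^ 2) • g = ((t - c) / ‖g‖) • a := by
    intro t
    rw [ha_def, smul_smul]
    congr 1
    field_simp
  set F : ℝ → ℝ≥0∞ := fun s => volume {y : ℝ × ℝ | (0 : EuclideanSpace ℝ (Fin 3)) + s • a +
    y.1 • U + y.2 • V ∈ S} with hF
  have hlhs : (fun t : ℝ => volume {y : ℝ × ℝ | ((t - c) / ‖g‖ ^ 2) • g + y.1 • U + y.2 • V ∈ S}) =
      fun t => F ((t - c) / ‖g‖) := by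
    funext t
    simp only [hF, hpt t, zero_add]
  rw [hlhs]
  -- substitution `t = ‖g‖ s + c`
  have hsub : ∫⁻ t, F ((t - c) / ‖g‖) = ENNReal.ofReal ‖g‖ * ∫⁻ s, F s := by
    have h1 : (fun t => F ((t - c) / ‖g‖)) = fun t => (fun u => F (‖g‖⁻¹ * u)) (t - c) := by
      funext t; simp only [div_eq_inv_mul]
    rw [h1, lintegral_sub_right_eq_self (fun u => F (‖g‖⁻¹ * u)) c]
    exact lintegral_comp_inv_mul F hgn
  rw [hsub, ← hcav]

/-- **Coarea formula for an affine function, chart-free (prism form).**  Let `g ≠ 0`, `c ∈ ℝ`,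
`f = ⟪g, ·⟫ + c`.  For every measurable `S ⊆ ℝ³` the volumes of the unit prisms erected (along the
unit normal `g/‖g‖`) over the level slices `S ∩ {f = t}` integrate to `‖g‖ · |S|`:
`∫⁻ t, |{y + τ g/‖g‖ : y ∈ S ∩ {f = t}, τ ∈ [0,1]}| = ‖g‖ · |S|`.  (The prism volume is the facet-area
notion of `anisotropicPerimeter_iInter_halfSpace_lt_eq_facetSum`; for an affine function on a cell
`c` this reads `∫ area({f = t} ∩ c) dt = ‖∇f‖ · |c|`.)
[cite: EvansGariepy2015, §3.4 Thm 3.10 and §3.4.4 Thm 3.13 (i) (coarea, m = 1), affine case = §1.4 Thm 1.22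
(Fubini) after a rotation; Maggi2012, Remark 20.3 p. 258 (facet areas as prism volumes)] -/
theorem lintegral_volume_prism_levelSet {g : EuclideanSpace ℝ (Fin 3)} (hg : g ≠ 0) (c : ℝ)
    {S : Set (EuclideanSpace ℝ (Fin 3))} (hS : MeasurableSet S) :
    ∫⁻ t : ℝ, volume {x : EuclideanSpace ℝ (Fin 3) |
        ∃ y ∈ S ∩ {x | ⟪g, x⟫ + c = t}, ∃ τ ∈ Set.Icc (0 : ℝ) 1, x = y + τ • (‖g‖⁻¹ • g)} =
      ENNReal.ofReal ‖g‖ * volume S := by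
  have hgn : 0 < ‖g‖ := norm_pos_iff.mpr hg
  set a : EuclideanSpace ℝ (Fin 3) := ‖g‖⁻¹ • g with ha_def
  have ha : ‖a‖ = 1 := by
    rw [ha_def, norm_smul, norm_inv, norm_norm, inv_mul_cancel₀ hgn.ne']
  obtain ⟨U, V, hU, hV, hUV, haU, haV⟩ := exists_orthonormal_pair_perp a
  have hgU : ⟪g, U⟫ = 0 := by
    have h : ⟪a, U⟫ = ‖g‖⁻¹ * ⟪g, U⟫ := by rw [ha_def, real_inner_smul_left]
    rw [haU] at h
    rcases mul_eq_zero.mp h.symm with h1 | h1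
    · exact absurd h1 (inv_ne_zero hgn.ne')
    · exact h1
  have hgV : ⟪g, V⟫ = 0 := by
    have h : ⟪a, V⟫ = ‖g‖⁻¹ * ⟪g, V⟫ := by rw [ha_def, real_inner_smul_left]
    rw [haV] at h
    rcases mul_eq_zero.mp h.symm with h1 | h1
    · exact absurd h1 (inv_ne_zero hgn.ne')
    · exact h1
  rw [← lintegral_volume_chartSlice_levelSet hg hU hV hUV hgU hgV c hS]
  congr 1
  funext t
  set pt : EuclideanSpace ℝ (Fin 3) := ((t - c) / ‖g‖ ^ 2) • g with hpt
  have hgg : ⟪g, g⟫ = ‖g‖ ^ 2 := real_inner_self_eq_norm_sq g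
  -- `pt` lies in the level plane `{f = t}`
  have hpt_level : ⟪g, pt⟫ + c = t := by
    rw [hpt, real_inner_smul_right, hgg]
    field_simp
    ring
  -- every point of the slice has the same `a`-height as `pt`
  have hF : ∀ y ∈ S ∩ {x : EuclideanSpace ℝ (Fin 3) | ⟪g, x⟫ + c = t}, ⟪a, y⟫ = ⟪a, pt⟫ := by
    rintro y ⟨-, hy⟩
    simp only [Set.mem_setOf_eq] at hy
    have h1 : ⟪g, y⟫ = ⟪g, pt⟫ := by linarith
    rw [ha_def, real_inner_smul_left, real_inner_smul_left, h1]
  rw [volume_prism_eq_volume_chartPreimage ha hU hV hUV haU haV hF]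
  congr 1
  ext y
  simp only [Set.mem_setOf_eq, Set.mem_inter_iff]
  constructor
  · rintro ⟨h, -⟩; exact h
  · intro h
    refine ⟨h, ?_⟩
    rw [inner_chart_eq hgU hgV pt y]
    exact hpt_level

end Literature.Analysis.Convexity

/-! ## Two conveniences for consumers: choosing a good level, and the prism direction -/

namespace Literature.Analysis.Convexity

/-- **A level not worse than the average.**  If `P` is a.e.-measurable on `(a, b)` (`a < b`) and
`∫⁻_{(a,b)} P ≤ C · (b − a)` with `C < ∞`, then `P t ≤ C` for some `t ∈ (a, b)` (else the integral would
be strictly larger).  Used to pick a level set `{u > t}` whose perimeter does not exceed the coarea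
average. [cite: EvansGariepy2015, §3.4.4 Thm 3.13 (ii) (integration over level sets) — the averaging
step; folklore (Markov)] -/
theorem exists_mem_Ioo_le_of_lintegral_le {P : ℝ → ℝ≥0∞} {a b : ℝ} (hab : a < b) {C : ℝ≥0∞}
    (hC : C ≠ ⊤) (hP : AEMeasurable P (volume.restrict (Set.Ioo a b)))
    (h : ∫⁻ t in Set.Ioo a b, P t ≤ C * ENNReal.ofReal (b - a)) :
    ∃ t ∈ Set.Ioo a b, P t ≤ C := by
  by_contra hcon
  push Not at hcon
  have hμ : volume.restrict (Set.Ioo a b) ≠ 0 := by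
    intro h0
    have h1 : volume.restrict (Set.Ioo a b) (Set.Ioo a b) = 0 := by rw [h0]; rfl
    rw [Measure.restrict_apply_self, Real.volume_Ioo] at h1
    have : (0 : ℝ≥0∞) < ENNReal.ofReal (b - a) := by
      rw [ENNReal.ofReal_pos]; linarith
    exact this.ne' h1
  have hconst : ∫⁻ _ in Set.Ioo a b, C = C * ENNReal.ofReal (b - a) := by
    rw [lintegral_const, Measure.restrict_apply_univ, Real.volume_Ioo]
  have hfin : ∫⁻ _ in Set.Ioo a b, C ≠ ⊤ := by
    rw [hconst]; exact ENNReal.mul_ne_top hC ENNReal.ofReal_ne_top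
  have hae : ∀ᵐ t ∂(volume.restrict (Set.Ioo a b)), C < P t :=
    (ae_restrict_iff' measurableSet_Ioo).mpr (Filter.Eventually.of_forall hcon)
  have hlt : ∫⁻ _ in Set.Ioo a b, C < ∫⁻ t in Set.Ioo a b, P t :=
    lintegral_strict_mono hμ hP hfin hae
  rw [hconst] at hlt
  exact absurd h (not_le.mpr hlt)

/-- **The prism volume does not depend on the side**: for `F` in a plane orthogonal to the unit vector
`a`, the unit prisms erected over `F` along `a` and along `−a` have the same volume (both equal the
chart area of `F`). [cite: Maggi2012, Remark 20.3 p. 258 (facet areas as prism volumes) — plumbing] -/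
theorem volume_prism_neg_eq {a U V p : EuclideanSpace ℝ (Fin 3)} (ha : ‖a‖ = 1)
    (hU : ‖U‖ = 1) (hV : ‖V‖ = 1) (hUV : ⟪U, V⟫ = 0) (haU : ⟪a, U⟫ = 0) (haV : ⟪a, V⟫ = 0)
    {F : Set (EuclideanSpace ℝ (Fin 3))} (hF : ∀ y ∈ F, ⟪a, y⟫ = ⟪a, p⟫) :
    volume {x : EuclideanSpace ℝ (Fin 3) | ∃ y ∈ F, ∃ t ∈ Set.Icc (0 : ℝ) 1, x = y + t • (-a)} =
      volume {x : EuclideanSpace ℝ (Fin 3) | ∃ y ∈ F, ∃ t ∈ Set.Icc (0 : ℝ) 1, x = y + t • a} := by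
  have hna : ‖-a‖ = 1 := by rw [norm_neg, ha]
  have hnaU : ⟪-a, U⟫ = 0 := by rw [inner_neg_left, haU, neg_zero]
  have hnaV : ⟪-a, V⟫ = 0 := by rw [inner_neg_left, haV, neg_zero]
  have hF' : ∀ y ∈ F, ⟪-a, y⟫ = ⟪-a, p⟫ := by
    intro y hy; rw [inner_neg_left, inner_neg_left, hF y hy]
  rw [volume_prism_eq_volume_chartPreimage hna hU hV hUV hnaU hnaV hF',
    volume_prism_eq_volume_chartPreimage ha hU hV hUV haU haV hF]

end Literature.Analysis.Convexity
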